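import Summits.QuantumFields.YangMills.Theses.LangevinControlUV
import Summits.QuantumFields.YangMills.Theorems.ParabolicTrajectoryLatticeGapOnTrajectoryTransferSymDefs

/-!
# Crux `GapToContinuum` (stmt-QuantumFields-8896): the gap transfer in slab-clustering currency (R6)

`--supports stmt-QuantumFields-8896` (route `LangevinControlUV`, sub-problem `YangMills`; lead c2 of
line `SketchIdeator5`).  The crux AS TYPED
(`IsYangMillsFor r sch T → HasLatticeMassGap r sch Δ → T.HasMassGap Δ`, per-pair constants AND
thresholds `∀ A B ∃ C ∀ᶠ k`) is certified unprovable-as-typed by four leads and the standing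
disproof (defects D1 β-sign, D2 per-pair thresholds vs the `k`-growing family of translated product
pairs, D3 absolute vs renormalised currency on the own time-periodic tori).  This file records, as a
closed theorem whose TYPE is a candidate re-typed crux text, the transfer that IS available in the
tree since the sibling crux `LatticeGapOnTrajectory` (stmt-QuantumFields-10523) landed its
symmetric slab-clustering bridge (`Transfer.transferHalfSym_of_uniformSlabClustering`, p121787 fed
with the site reflection positivity p120012):

* `gapToContinuum_slabTransfer` (RAW BODY, pasteable as a route statement): for every compact `G`,
  `r`, scheme `sch`, OS datum `T` and `Δ > 0` — `M`-adic spacings `a_k = M^{-n_k}` (`M ≥ 2`),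
  `β_k → +∞` (`HasWeakCouplingLimit`, already a conjunct of `YangMills` and free in `closes`),
  physical volume growth `a_k L_k / log(a_k⁻¹) → ∞`, reflection-symmetric and polynomially bounded
  witness renormalisations, `IsYangMillsFor r sch T`, and UNIFORM SLAB CLUSTERING at physical rate
  `Δ` in cluster-expansion (sup-norm) format on the scheme's OWN tori
  (`‖osCorr μ_k Θ₀ τ_N X X‖ ≤ K (a_k⁻¹ (w+1)(L_k+1))^p B² e^{−Δ a_k N}` for every bounded measurable
  slab observable `X`, eventually in `k` uniformly in `(w, N, X)`) imply `T.HasMassGap Δ` — SAME rate.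
* `gapToContinuum_of_uniformSlabClustering`: the same with the sibling's names
  (`Transfer.UniformSlabClustering`, `SpeciesScheme.HasVolumeGrowth`,
  `Transfer.HasPolynomialRenormalisations`).

Why this currency (and not the typed `HasLatticeMassGap`): what transfers from the lattice is
POSITIVITY, not per-pair constants; the Hankel log-convexity chain on the odd torus converts a
sup-norm far bound into an OS-currency bound at the same rate with loss factor `C_k^{2^{-J_k}}`, which
tends to `1` exactly when the constants are polynomial in the cutoff and `a_k L_k ≫ log(a_k⁻¹)`
(sibling NOTES §c2).  The typed hypothesis supplies neither the uniformity over the `k`-dependent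
composite observables nor the volume clause.

Planner's menu for 8896 (all kernel-closed): R1 `sch.HasCSClustering r Δ` (Restatement.lean, seat -0),
R4 `TorusOSGapSlack` + side conditions (RestatementC1.lean), R5 `HasDiagClustering`
(RestatementA1.lean), R6 = this file (lattice-only, sup-norm currency, consumable by IR engines).
-/

noncomputable section

namespace Summit.QuantumFields.YangMills.Theorems.GapToContinuum.SlabTransfer

open scoped ComplexConjugate
open Filter MeasureTheory
open Literature.MathematicalPhysics.QuantumLattice Literature.MathematicalPhysics.QuantumFieldTheory
open Summit.QuantumFields.YangMills.Cruxes.LatticeGapOnTrajectory.OrbitKantorovichFiniteSize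

/-- **R6 — the gap transfer in slab-clustering currency (raw body).**  For every compact gauge group
`G`, lattice representation `r`, scheme `sch`, OS datum `T` and `Δ > 0`: `M`-adic spacings,
`β_k → +∞`, `a_k L_k / log(a_k⁻¹) → ∞`, reflection-symmetric polynomially bounded renormalisations,
`IsYangMillsFor r sch T` and uniform slab clustering at physical rate `Δ` in cluster-expansion format
on the scheme's own tori give the full-spectrum continuum gap `T.HasMassGap Δ` at the SAME rate.
One line from the sibling crux's landed bridge `Transfer.transferHalfSym_of_uniformSlabClustering`
(stmt-QuantumFields-10523, p121787 + p120012) at `sch' = sch`.  (`0 < Δ` is idle, kept to match the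
crux's shape.) -/
theorem gapToContinuum_slabTransfer :
    ∀ (G : Type) [Group G] [TopologicalSpace G] [IsTopologicalGroup G] [CompactSpace G]
      [MeasurableSpace G] [BorelSpace G] (r : LatticeRep G) (sch : SpeciesScheme (YMSpecies G))
      (T : OSData (YMSpecies G) 4) (Δ : ℝ), 0 < Δ →
      (∃ (M : ℕ) (n : ℕ → ℕ), 2 ≤ M ∧ ∀ k, sch.a k = ((M : ℝ) ^ n k)⁻¹) →
      sch.HasWeakCouplingLimit →
      Tendsto (fun k => sch.a k * sch.L k / Real.log (sch.a k)⁻¹) atTop atTop →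
      sch.IsReflectionSymmetric →
      (∀ s, ∃ (q : ℕ) (K : ℝ), ∀ k,
        |sch.c s k| ≤ K * ((sch.a k)⁻¹) ^ q ∧ |sch.m s k| ≤ K * ((sch.a k)⁻¹) ^ q) →
      IsYangMillsFor r sch T →
      (∃ (p : ℕ) (K : ℝ), 0 ≤ K ∧ ∀ᶠ k in atTop,
        ∀ (w N : ℕ) (X : GaugeConfig 4 (sch.side k) G → ℂ) (B : ℝ), Measurable X →
          (∀ U, ‖X U‖ ≤ B) →
          DependsOn X {e : Edge 4 (sch.side k) | 1 ≤ (e.1 0).val ∧ (e.1 0).val ≤ w} →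
          N + 2 * w ≤ sch.L k →
            ‖osCorr (wilsonMeasure r.ρ (sch.β k)) GaugeConfig.negReflect
                (torusTimeShift (sch.side k) N) X X‖ ≤
              K * ((sch.a k)⁻¹ * ((w : ℝ) + 1) * ((sch.L k : ℝ) + 1)) ^ p * B ^ 2 *
                Real.exp (-Δ * sch.a k * N)) →
      T.HasMassGap Δ := by
  intro G _ _ _ _ _ _ r sch T Δ _ hshape hW hvol hsym hpoly hYM hclust
  obtain ⟨M, n, hM, hshape⟩ := hshape
  exact Transfer.transferHalfSym_of_uniformSlabClustering r sch hM hshape hW hvol hclust sch rfl rfl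
    rfl hsym hpoly T hYM

/-- **R6 with the sibling's names**: `M`-adic shape, `HasWeakCouplingLimit`, `HasVolumeGrowth`,
`IsReflectionSymmetric`, `HasPolynomialRenormalisations`, `IsYangMillsFor` and
`UniformSlabClustering r sch Δ` give `T.HasMassGap Δ`. -/
theorem gapToContinuum_of_uniformSlabClustering {G : Type} [Group G] [TopologicalSpace G]
    [IsTopologicalGroup G] [CompactSpace G] [MeasurableSpace G] [BorelSpace G] (r : LatticeRep G)
    {sch : SpeciesScheme (YMSpecies G)} {T : OSData (YMSpecies G) 4} {Δ : ℝ} {M : ℕ} {n : ℕ → ℕ}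
    (hM : 2 ≤ M) (hshape : ∀ k, sch.a k = ((M : ℝ) ^ n k)⁻¹) (hW : sch.HasWeakCouplingLimit)
    (hvol : sch.HasVolumeGrowth) (hsym : sch.IsReflectionSymmetric)
    (hpoly : Transfer.HasPolynomialRenormalisations sch) (hYM : IsYangMillsFor r sch T)
    (hclust : Transfer.UniformSlabClustering r sch Δ) : T.HasMassGap Δ :=
  Transfer.transferHalfSym_of_uniformSlabClustering r sch hM hshape hW hvol hclust sch rfl rfl rfl
    hsym hpoly T hYM

end Summit.QuantumFields.YangMills.Theorems.GapToContinuum.SlabTransfer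

end
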